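import Literature.Topology.PlanarFoliations.LeafStructure
import HarnessLib

/-!
# The linear order of an open leaf of a bi-oriented foliation

Topic: Topology / PlanarFoliations, sequel to `LeafStructure.lean`. A non-compact leaf `L = F.Leaf x`
of a bi-oriented foliation with one-dimensional leaves is exhausted by a nested sequence of arc
charts agreeing with the leaf arcs, with increasing transitions
(`exists_nested_agreeing_arcCharts`). Fixing such a sequence once and for all (`lineCharts`),
the leaf becomes an **oriented line**:

* `leafLT` (**definition**): `p < q` iff some chart of the sequence containing both reads
  `p` before `q`; this does not depend on the chart (`lt_iff_lt_lineCharts`: all transitions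
  `g n ∘ (g m)⁻¹`, `m ≤ n`, are increasing, `strictMono_transition`), and is a strict total order
  (`leafLT_irrefl`, `leafLT_trans`, `leafLT_trichotomy`);
* **the order is the one of the leaf arcs** (`leafArc_lt_iff`): along every plaque the leaf
  coordinate of the flow box increases with `leafLT` — so `leafLT` is the forward direction of
  the bi-oriented atlas, read globally on the leaf;
* sources of the charts are order-convex (`mem_lineCharts_source_of_between`), and every
  compact subset of the leaf lies in the source of one chart (`exists_subset_lineCharts_source`),
  so that order intervals can be read as real intervals in one chart.

All statements are [folklore] (the leaves of an oriented foliation with one-dimensional leaves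
are oriented curves; Camacho–Lins Neto Ch. VI §4, Hector–Hirsch A Ch. II 2.2).
-/

noncomputable section

open Set Filter Function
open _root_.Topology
open Literature.Topology.FourManifolds Literature.Topology.FourManifolds.Foliation
  Literature.Topology.FourManifolds.OneManifold

namespace Literature.Topology.PlanarFoliations

variable {X : Type*} [TopologicalSpace X] [T2Space X] [SecondCountableTopology X] {F : Foliation ℝ X} {x : X}

section OpenLeaf

variable [NoncompactSpace (F.Leaf x)] (hbi : IsBiOriented F)

/-- **The line charts of an open leaf**: a chosen nested exhausting sequence of arc charts
agreeing with the leaf arcs, with increasing transitions. [folklore] -/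
def lineCharts (hbi : IsBiOriented F) (x : X) [NoncompactSpace (F.Leaf x)] : ℕ → OpenPartialHomeomorph (F.Leaf x) ℝ :=
  (exists_nested_agreeing_arcCharts (x := x) hbi).choose

/-- The defining properties of the line charts. [folklore] -/
theorem lineCharts_spec :
    (∀ n, (lineCharts hbi x n).target = univ) ∧
      (∀ n, (lineCharts hbi x n).source ⊆ (lineCharts hbi x (n + 1)).source) ∧
      (⋃ n, (lineCharts hbi x n).source) = univ ∧
      (∀ n, StrictMono (lineCharts hbi x (n + 1) ∘ (lineCharts hbi x n).symm)) ∧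
      ∀ n, AgreesWithLeafArcs (lineCharts hbi x n) :=
  (exists_nested_agreeing_arcCharts (x := x) hbi).choose_spec

/-- Line charts are arc charts. [folklore] -/
theorem lineCharts_target (n : ℕ) : (lineCharts hbi x n).target = univ := (lineCharts_spec hbi).1 n

/-- Line charts agree with the leaf arcs. [folklore] -/
theorem agreesWithLeafArcs_lineCharts (n : ℕ) : AgreesWithLeafArcs (lineCharts hbi x n) := (lineCharts_spec hbi).2.2.2.2 n

/-- The sources of the line charts increase. [folklore] -/
theorem lineCharts_source_mono {m n : ℕ} (hmn : m ≤ n) : (lineCharts hbi x m).source ⊆ (lineCharts hbi x n).source := by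
  induction hmn with
  | refl => exact Subset.rfl
  | step _ ih => exact ih.trans ((lineCharts_spec hbi).2.1 _)

/-- Every point lies in the source of some line chart. [folklore] -/
theorem exists_mem_lineCharts_source (p : F.Leaf x) : ∃ n, p ∈ (lineCharts hbi x n).source := by
  have : p ∈ ⋃ n, (lineCharts hbi x n).source := by rw [(lineCharts_spec hbi).2.2.1]; exact mem_univ _
  exact mem_iUnion.1 this

/-- Any two points lie in the source of a common line chart. [folklore] -/
theorem exists_mem_lineCharts_source₂ (p q : F.Leaf x) :
    ∃ n, p ∈ (lineCharts hbi x n).source ∧ q ∈ (lineCharts hbi x n).source := by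
  obtain ⟨m, hm⟩ := exists_mem_lineCharts_source hbi p
  obtain ⟨n, hn⟩ := exists_mem_lineCharts_source hbi q
  exact ⟨max m n, lineCharts_source_mono hbi (le_max_left _ _) hm, lineCharts_source_mono hbi (le_max_right _ _) hn⟩

/-- **All transitions between line charts are increasing** (composites of the increasing
transitions between consecutive ones). [folklore] -/
theorem strictMono_transition {m n : ℕ} (hmn : m ≤ n) :
    StrictMono (lineCharts hbi x n ∘ (lineCharts hbi x m).symm) := by
  induction hmn with
  | refl =>
    intro s t hst
    simp only [comp_apply, arc_apply_symm (lineCharts_target hbi m)]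
    exact hst
  | step hle ih =>
    rename_i k
    have heq : (lineCharts hbi x (k + 1) ∘ (lineCharts hbi x m).symm) =
        (lineCharts hbi x (k + 1) ∘ (lineCharts hbi x k).symm) ∘ (lineCharts hbi x k ∘ (lineCharts hbi x m).symm) := by
      funext t
      have hmem : (lineCharts hbi x m).symm t ∈ (lineCharts hbi x k).source :=
        lineCharts_source_mono hbi hle (arc_symm_mem (lineCharts_target hbi m) t)
      simp only [comp_apply, (lineCharts hbi x k).left_inv hmem]
    rw [heq]
    exact ((lineCharts_spec hbi).2.2.2.1 k).comp ih

/-- **The order read in a line chart does not depend on the chart.** [folklore] -/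
theorem lt_iff_lt_lineCharts {m n : ℕ} (hmn : m ≤ n) {p q : F.Leaf x} (hp : p ∈ (lineCharts hbi x m).source)
    (hq : q ∈ (lineCharts hbi x m).source) :
    lineCharts hbi x m p < lineCharts hbi x m q ↔ lineCharts hbi x n p < lineCharts hbi x n q := by
  have h := (strictMono_transition (x := x) hbi hmn).lt_iff_lt (a := lineCharts hbi x m p) (b := lineCharts hbi x m q)
  simp only [comp_apply, (lineCharts hbi x m).left_inv hp, (lineCharts hbi x m).left_inv hq] at h
  exact h.symm

/-! ### The order -/

/-- **The linear order of an open leaf**: `p` is before `q` iff some line chart containing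
both reads `p` before `q`. [folklore] -/
def leafLT (p q : F.Leaf x) : Prop :=
  ∃ n, p ∈ (lineCharts hbi x n).source ∧ q ∈ (lineCharts hbi x n).source ∧ lineCharts hbi x n p < lineCharts hbi x n q

variable {hbi} {p q r : F.Leaf x} {n : ℕ}

/-- **The order read in any line chart containing the two points.** [folklore] -/
theorem leafLT_iff (hp : p ∈ (lineCharts hbi x n).source) (hq : q ∈ (lineCharts hbi x n).source) :
    leafLT hbi p q ↔ lineCharts hbi x n p < lineCharts hbi x n q := by
  constructor
  · rintro ⟨m, hpm, hqm, hlt⟩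
    rw [lt_iff_lt_lineCharts hbi (le_max_left m n) hpm hqm] at hlt
    rwa [lt_iff_lt_lineCharts hbi (le_max_right m n) hp hq]
  · exact fun h ↦ ⟨n, hp, hq, h⟩

/-- The order is irreflexive. [folklore] -/
theorem leafLT_irrefl (p : F.Leaf x) : ¬ leafLT hbi p p := fun ⟨_, _, _, h⟩ ↦ lt_irrefl _ h

/-- The order is transitive. [folklore] -/
theorem leafLT_trans (h₁ : leafLT hbi p q) (h₂ : leafLT hbi q r) : leafLT hbi p r := by
  obtain ⟨n, hp, hq⟩ := exists_mem_lineCharts_source₂ hbi p q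
  obtain ⟨m, hr⟩ := exists_mem_lineCharts_source hbi r
  set N := max n m
  have hp' := lineCharts_source_mono hbi (le_max_left n m) hp
  have hq' := lineCharts_source_mono hbi (le_max_left n m) hq
  have hr' := lineCharts_source_mono hbi (le_max_right n m) hr
  rw [leafLT_iff hp' hq'] at h₁
  rw [leafLT_iff hq' hr'] at h₂
  rw [leafLT_iff hp' hr']
  exact h₁.trans h₂

/-- The order is asymmetric. [folklore] -/
theorem leafLT_asymm (h : leafLT hbi p q) : ¬ leafLT hbi q p := fun h' ↦ leafLT_irrefl p (leafLT_trans h h')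

/-- **Trichotomy**: the order is total. [folklore] -/
theorem leafLT_trichotomy (p q : F.Leaf x) : leafLT hbi p q ∨ p = q ∨ leafLT hbi q p := by
  obtain ⟨n, hp, hq⟩ := exists_mem_lineCharts_source₂ hbi p q
  rcases lt_trichotomy (lineCharts hbi x n p) (lineCharts hbi x n q) with h | h | h
  · exact Or.inl ((leafLT_iff hp hq).2 h)
  · exact Or.inr (Or.inl ((lineCharts hbi x n).injOn hp hq h))
  · exact Or.inr (Or.inr ((leafLT_iff hq hp).2 h))

/-- `¬ (q < p)` iff `p < q ∨ p = q`. [folklore] -/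
theorem not_leafLT_iff : ¬ leafLT hbi q p ↔ leafLT hbi p q ∨ p = q := by
  constructor
  · intro h
    rcases leafLT_trichotomy (hbi := hbi) p q with h' | h' | h'
    · exact Or.inl h'
    · exact Or.inr h'
    · exact absurd h' h
  · rintro (h | rfl)
    · exact leafLT_asymm h
    · exact leafLT_irrefl p

/-! ### The order along the leaf arcs -/

/-- **The sources of the line charts are order-convex**: a point between two points of the
source of a line chart lies in it (the source is an arc of the line). [folklore] -/
theorem mem_lineCharts_source_of_between (hp : p ∈ (lineCharts hbi x n).source) (hq : q ∈ (lineCharts hbi x n).source)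
    (h₁ : ¬ leafLT hbi r p) (h₂ : ¬ leafLT hbi q r) : r ∈ (lineCharts hbi x n).source := by
  obtain ⟨m, hr⟩ := exists_mem_lineCharts_source hbi r
  set N := max n m with hN
  have hp' := lineCharts_source_mono hbi (le_max_left n m) hp
  have hq' := lineCharts_source_mono hbi (le_max_left n m) hq
  have hr' := lineCharts_source_mono hbi (le_max_right n m) hr
  -- in the chart `N`, the source of the chart `n` is an interval containing the readings of `p`, `q`
  have hoc : (lineCharts hbi x N '' (lineCharts hbi x n).source).OrdConnected :=
    ordConnected_image (arc_isConnected_source (lineCharts_target hbi n)).isPreconnected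
      (lineCharts_source_mono hbi (le_max_left n m))
  have h₁' : lineCharts hbi x N p ≤ lineCharts hbi x N r := by
    rcases not_leafLT_iff.1 h₁ with h | rfl
    · exact ((leafLT_iff hp' hr').1 h).le
    · exact le_rfl
  have h₂' : lineCharts hbi x N r ≤ lineCharts hbi x N q := by
    rcases not_leafLT_iff.1 h₂ with h | rfl
    · exact ((leafLT_iff hr' hq').1 h).le
    · exact le_rfl
  have hmem : lineCharts hbi x N r ∈ lineCharts hbi x N '' (lineCharts hbi x n).source :=
    hoc.out (mem_image_of_mem _ hp) (mem_image_of_mem _ hq) ⟨h₁', h₂'⟩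
  obtain ⟨r', hr'n, heq⟩ := hmem
  have : r' = r := (lineCharts hbi x N).injOn (lineCharts_source_mono hbi (le_max_left n m) hr'n) hr' heq
  rwa [← this]

/-- A compact connected subset of the leaf lies in the source of one line chart. [folklore] -/
theorem exists_subset_lineCharts_source {K : Set (F.Leaf x)} (hK : IsCompact K) :
    ∃ n, K ⊆ (lineCharts hbi x n).source := by
  have hcov : K ⊆ ⋃ n, (lineCharts hbi x n).source := by rw [(lineCharts_spec hbi).2.2.1]; exact subset_univ _
  obtain ⟨T, hT⟩ := hK.elim_finite_subcover _ (fun n ↦ (lineCharts hbi x n).open_source) hcov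
  rcases T.eq_empty_or_nonempty with h | h
  · refine ⟨0, fun r hr ↦ ?_⟩
    rw [h] at hT
    exact absurd (hT hr) (by simp)
  · refine ⟨T.max' h, fun r hr ↦ ?_⟩
    obtain ⟨n, hn, hrn⟩ := mem_iUnion₂.1 (hT hr)
    exact lineCharts_source_mono hbi (T.le_max' n hn) hrn

/-- **The order along a leaf arc is the leaf coordinate**: for two points of the plaque of a
leaf arc, `p < q` in the leaf iff the flow box reads `p` before `q`. The sub-arc between them
is compact, hence inside one line chart and inside one component of the overlap with the leaf
arc, on which the transition is increasing (decreasing would contradict the local agreement).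
[folklore] -/
theorem leafArc_lt_iff {e : OpenPartialHomeomorph X (ℝ × ℝ)} (he : e ∈ F.atlas) {t : ℝ} (h : plaque e t ⊆ F.leaf x)
    (hp : p ∈ (leafArc e t h he).source) (hq : q ∈ (leafArc e t h he).source) :
    leafArc e t h he p < leafArc e t h he q ↔ leafLT hbi p q := by
  set c := leafArc e t h he with hc
  have hct : c.target = univ := leafArc_target h he
  -- the sub-arc of `c` between the readings of `p` and `q`
  set a := min (c p) (c q) with ha
  set b := max (c p) (c q) with hb
  set K : Set (F.Leaf x) := c.symm '' Icc a b with hKdef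
  have hKc : IsCompact K := isCompact_Icc.image (arc_continuous_symm hct)
  have hKconn : IsPreconnected K := isPreconnected_Icc.image _ (arc_continuous_symm hct).continuousOn
  have hKsrc : K ⊆ c.source := by rintro _ ⟨s, -, rfl⟩; exact arc_symm_mem hct s
  have hpK : p ∈ K := ⟨c p, ⟨min_le_left _ _, le_max_left _ _⟩, c.left_inv hp⟩
  have hqK : q ∈ K := ⟨c q, ⟨min_le_right _ _, le_max_right _ _⟩, c.left_inv hq⟩
  obtain ⟨n, hKn⟩ := exists_subset_lineCharts_source (hbi := hbi) hKc
  set g := lineCharts hbi x n with hg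
  -- `K` lies in one component of the overlap of `g` and `c`
  set Kp := connectedComponentIn (g.source ∩ c.source) p with hKp
  have hKKp : K ⊆ Kp := hKconn.subset_connectedComponentIn hpK fun r hr ↦ ⟨hKn hr, hKsrc hr⟩
  -- the transition `c ∘ g.symm` is increasing on `g '' Kp`
  have hmono : StrictMonoOn (c ∘ g.symm) (g '' Kp) := by
    rcases transition_strictMonoOn_or_strictAntiOn (lineCharts_target hbi n) c p with hm | hanti
    · exact hm
    · exfalso
      -- decreasing transition: `g` disagrees locally with `c` at `p`, against `AgreesWithLeafArcs`
      have hKo : IsOpen (g '' Kp) := g.isOpen_image_of_subset_source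
        ((g.open_source.inter c.open_source).connectedComponentIn) ((connectedComponentIn_subset _ _).trans inter_subset_left)
      have hdis : LocDisagree g c p := by
        have h' := eventually_lt_iff_of_strictMonoOn (c := c.transHomeomorph (Homeomorph.neg ℝ)) hKo
          (by rw [lineCharts_target hbi n]; exact subset_univ _) (strictMonoOn_neg_of_strictAntiOn hanti)
          ⟨g p, mem_image_of_mem g (mem_connectedComponentIn ⟨hKn hpK, hp⟩), g.left_inv (hKn hpK)⟩
        exact h'.mono fun q hq ↦ by
          simp only [neg_chart_apply, neg_lt_neg_iff] at hq
          exact hq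
      exact not_locAgree_of_locDisagree hct hp (agreesWithLeafArcs_lineCharts hbi n p (hKn hpK) e he t h hp) hdis
  have hpg : g p ∈ g '' Kp := mem_image_of_mem g (hKKp hpK)
  have hqg : g q ∈ g '' Kp := mem_image_of_mem g (hKKp hqK)
  have key := hmono.lt_iff_lt hpg hqg
  simp only [comp_apply, g.left_inv (hKn hpK), g.left_inv (hKn hqK)] at key
  rw [key, leafLT_iff (hKn hpK) (hKn hqK)]

/-! ### Order topology: rays are open, intervals are arcs -/

/-- **Forward rays are open** in the leaf topology. [folklore] -/
theorem isOpen_setOf_leafLT_right (r : F.Leaf x) : IsOpen {s | leafLT hbi r s} := by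
  refine isOpen_iff_mem_nhds.2 fun s₀ hs₀ ↦ ?_
  obtain ⟨n, hr, hs₀n⟩ := exists_mem_lineCharts_source₂ hbi r s₀
  have ho : IsOpen ((lineCharts hbi x n).source ∩ lineCharts hbi x n ⁻¹' Ioi (lineCharts hbi x n r)) :=
    (lineCharts hbi x n).continuousOn.isOpen_inter_preimage (lineCharts hbi x n).open_source isOpen_Ioi
  refine mem_of_superset (ho.mem_nhds ⟨hs₀n, (leafLT_iff hr hs₀n).1 hs₀⟩) ?_
  rintro s ⟨hs, hlt⟩
  exact (leafLT_iff hr hs).2 hlt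

/-- **Backward rays are open** in the leaf topology. [folklore] -/
theorem isOpen_setOf_leafLT_left (r : F.Leaf x) : IsOpen {s | leafLT hbi s r} := by
  refine isOpen_iff_mem_nhds.2 fun s₀ hs₀ ↦ ?_
  obtain ⟨n, hr, hs₀n⟩ := exists_mem_lineCharts_source₂ hbi r s₀
  have ho : IsOpen ((lineCharts hbi x n).source ∩ lineCharts hbi x n ⁻¹' Iio (lineCharts hbi x n r)) :=
    (lineCharts hbi x n).continuousOn.isOpen_inter_preimage (lineCharts hbi x n).open_source isOpen_Iio
  refine mem_of_superset (ho.mem_nhds ⟨hs₀n, (leafLT_iff hs₀n hr).1 hs₀⟩) ?_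
  rintro s ⟨hs, hlt⟩
  exact (leafLT_iff hs hr).2 hlt

variable (hbi) in
/-- **Order intervals** `[p, q]` of the leaf. [folklore] -/
def leafIcc (p q : F.Leaf x) : Set (F.Leaf x) := {r | ¬ leafLT hbi r p ∧ ¬ leafLT hbi q r}

/-- **An order interval is a real interval read in any line chart containing its ends.**
[folklore] -/
theorem leafIcc_eq_image (hp : p ∈ (lineCharts hbi x n).source) (hq : q ∈ (lineCharts hbi x n).source) :
    leafIcc hbi p q = (lineCharts hbi x n).symm '' Icc (lineCharts hbi x n p) (lineCharts hbi x n q) := by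
  ext r
  constructor
  · rintro ⟨h₁, h₂⟩
    have hr : r ∈ (lineCharts hbi x n).source := mem_lineCharts_source_of_between hp hq h₁ h₂
    refine ⟨lineCharts hbi x n r, ⟨?_, ?_⟩, (lineCharts hbi x n).left_inv hr⟩
    · rcases not_leafLT_iff.1 h₁ with h | h
      · exact ((leafLT_iff hp hr).1 h).le
      · rw [h]
    · rcases not_leafLT_iff.1 h₂ with h | h
      · exact ((leafLT_iff hr hq).1 h).le
      · rw [h]
  · rintro ⟨s, ⟨hs₁, hs₂⟩, rfl⟩
    have hr : (lineCharts hbi x n).symm s ∈ (lineCharts hbi x n).source := arc_symm_mem (lineCharts_target hbi n) s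
    have hgr : lineCharts hbi x n ((lineCharts hbi x n).symm s) = s := arc_apply_symm (lineCharts_target hbi n) s
    constructor
    · intro h
      have := (leafLT_iff hr hp).1 h
      rw [hgr] at this
      linarith
    · intro h
      have := (leafLT_iff hq hr).1 h
      rw [hgr] at this
      linarith

/-- **Order intervals are compact.** [folklore] -/
theorem isCompact_leafIcc (p q : F.Leaf x) : IsCompact (leafIcc hbi p q) := by
  obtain ⟨n, hp, hq⟩ := exists_mem_lineCharts_source₂ hbi p q
  rw [leafIcc_eq_image hp hq]
  exact isCompact_Icc.image (arc_continuous_symm (lineCharts_target hbi n))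

/-- **Order intervals are preconnected.** [folklore] -/
theorem isPreconnected_leafIcc (p q : F.Leaf x) : IsPreconnected (leafIcc hbi p q) := by
  obtain ⟨n, hp, hq⟩ := exists_mem_lineCharts_source₂ hbi p q
  rw [leafIcc_eq_image hp hq]
  exact isPreconnected_Icc.image _ (arc_continuous_symm (lineCharts_target hbi n)).continuousOn

/-- The ends belong to the interval (when `p ≤ q`). [folklore] -/
theorem left_mem_leafIcc (hpq : ¬ leafLT hbi q p) : p ∈ leafIcc hbi p q := ⟨leafLT_irrefl p, hpq⟩

/-- The ends belong to the interval (when `p ≤ q`). [folklore] -/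
theorem right_mem_leafIcc (hpq : ¬ leafLT hbi q p) : q ∈ leafIcc hbi p q := ⟨hpq, leafLT_irrefl q⟩

/-- **A preconnected set containing `p` and `q` contains the interval between them** (the leaf
minus a point between `p` and `q` is disconnected by the two open rays). [folklore] -/
theorem leafIcc_subset_of_isPreconnected {A : Set (F.Leaf x)} (hA : IsPreconnected A) (hp : p ∈ A) (hq : q ∈ A) :
    leafIcc hbi p q ⊆ A := by
  intro r ⟨h₁, h₂⟩
  by_contra hr
  have hcov : A ⊆ {s | leafLT hbi s r} ∪ {s | leafLT hbi r s} := by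
    intro s hs
    rcases leafLT_trichotomy (hbi := hbi) s r with h | h | h
    · exact Or.inl h
    · exact absurd hs (h ▸ hr)
    · exact Or.inr h
  have hdisj : Disjoint {s | leafLT hbi s r} {s | leafLT hbi r s} :=
    Set.disjoint_left.2 fun s hs hs' ↦ leafLT_asymm hs hs'
  rcases hA.subset_or_subset (isOpen_setOf_leafLT_left r) (isOpen_setOf_leafLT_right r) hdisj hcov with h | h
  · -- `A` is before `r`, but `q ∈ A` is not before `r`
    rcases not_leafLT_iff.1 h₂ with h' | h'
    · exact leafLT_asymm (h hq) h'
    · exact hr (h' ▸ hq)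
  · rcases not_leafLT_iff.1 h₁ with h' | h'
    · exact leafLT_asymm (h hp) h'
    · exact hr (h'.symm ▸ hp)

/-- **The plaques are order-convex**: a point between two points of the source of a leaf arc
lies in it. [folklore] -/
theorem mem_leafArc_source_of_between {e : OpenPartialHomeomorph X (ℝ × ℝ)} (he : e ∈ F.atlas) {t : ℝ}
    (h : plaque e t ⊆ F.leaf x) (hp : p ∈ (leafArc e t h he).source) (hq : q ∈ (leafArc e t h he).source)
    (h₁ : ¬ leafLT hbi r p) (h₂ : ¬ leafLT hbi q r) : r ∈ (leafArc e t h he).source := by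
  set c := leafArc e t h he
  have hct : c.target = univ := leafArc_target h he
  set A : Set (F.Leaf x) := c.symm '' Icc (min (c p) (c q)) (max (c p) (c q)) with hAdef
  have hAconn : IsPreconnected A := isPreconnected_Icc.image _ (arc_continuous_symm hct).continuousOn
  have hpA : p ∈ A := ⟨c p, ⟨min_le_left _ _, le_max_left _ _⟩, c.left_inv hp⟩
  have hqA : q ∈ A := ⟨c q, ⟨min_le_right _ _, le_max_right _ _⟩, c.left_inv hq⟩
  have hrA : r ∈ A := leafIcc_subset_of_isPreconnected hAconn hpA hqA ⟨h₁, h₂⟩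
  obtain ⟨s, -, rfl⟩ := hrA
  exact arc_symm_mem hct s

/-- **Points just after `p` accumulate at `p`.** [folklore] -/
theorem frequently_leafLT_right (p : F.Leaf x) : ∃ᶠ q in 𝓝 p, leafLT hbi p q := by
  obtain ⟨n, hp⟩ := exists_mem_lineCharts_source hbi p
  rw [frequently_iff]
  intro U hU
  have hc : ContinuousAt (fun ε : ℝ ↦ (lineCharts hbi x n).symm (lineCharts hbi x n p + ε)) 0 :=
    ((arc_continuous_symm (lineCharts_target hbi n)).continuousAt).comp (by fun_prop)
  have h0 : (lineCharts hbi x n).symm (lineCharts hbi x n p + 0) = p := by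
    rw [add_zero, (lineCharts hbi x n).left_inv hp]
  have hU' := hc.preimage_mem_nhds (by rw [h0]; exact hU)
  obtain ⟨ε, hε, hball⟩ := Metric.mem_nhds_iff.1 hU'
  refine ⟨(lineCharts hbi x n).symm (lineCharts hbi x n p + ε / 2), hball ?_, ?_⟩
  · rw [Metric.mem_ball, Real.dist_eq, sub_zero, abs_of_pos (by positivity)]; linarith
  · rw [leafLT_iff hp (arc_symm_mem (lineCharts_target hbi n) _), arc_apply_symm (lineCharts_target hbi n)]
    linarith

/-- **Points just before `p` accumulate at `p`.** [folklore] -/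
theorem frequently_leafLT_left (p : F.Leaf x) : ∃ᶠ q in 𝓝 p, leafLT hbi q p := by
  obtain ⟨n, hp⟩ := exists_mem_lineCharts_source hbi p
  rw [frequently_iff]
  intro U hU
  have hc : ContinuousAt (fun ε : ℝ ↦ (lineCharts hbi x n).symm (lineCharts hbi x n p - ε)) 0 :=
    ((arc_continuous_symm (lineCharts_target hbi n)).continuousAt).comp (by fun_prop)
  have h0 : (lineCharts hbi x n).symm (lineCharts hbi x n p - 0) = p := by
    rw [sub_zero, (lineCharts hbi x n).left_inv hp]
  have hU' := hc.preimage_mem_nhds (by rw [h0]; exact hU)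
  obtain ⟨ε, hε, hball⟩ := Metric.mem_nhds_iff.1 hU'
  refine ⟨(lineCharts hbi x n).symm (lineCharts hbi x n p - ε / 2), hball ?_, ?_⟩
  · rw [Metric.mem_ball, Real.dist_eq, sub_zero, abs_of_pos (by positivity)]; linarith
  · rw [leafLT_iff (arc_symm_mem (lineCharts_target hbi n) _) hp, arc_apply_symm (lineCharts_target hbi n)]
    linarith

variable (hbi) in
/-- **Open order intervals** `(p, q)` of the leaf. [folklore] -/
def leafIoo (p q : F.Leaf x) : Set (F.Leaf x) := {r | leafLT hbi p r ∧ leafLT hbi r q}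

/-- An open order interval lies in the closed one. [folklore] -/
theorem leafIoo_subset_leafIcc : leafIoo hbi p q ⊆ leafIcc hbi p q := fun _ ⟨h₁, h₂⟩ ↦ ⟨leafLT_asymm h₁, leafLT_asymm h₂⟩

/-- An open order interval is a real open interval read in a line chart containing its ends.
[folklore] -/
theorem leafIoo_eq_image (hp : p ∈ (lineCharts hbi x n).source) (hq : q ∈ (lineCharts hbi x n).source) :
    leafIoo hbi p q = (lineCharts hbi x n).symm '' Ioo (lineCharts hbi x n p) (lineCharts hbi x n q) := by
  ext r
  constructor
  · rintro ⟨h₁, h₂⟩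
    have hr : r ∈ (lineCharts hbi x n).source :=
      mem_lineCharts_source_of_between hp hq (leafLT_asymm h₁) (leafLT_asymm h₂)
    exact ⟨lineCharts hbi x n r, ⟨(leafLT_iff hp hr).1 h₁, (leafLT_iff hr hq).1 h₂⟩, (lineCharts hbi x n).left_inv hr⟩
  · rintro ⟨s, ⟨hs₁, hs₂⟩, rfl⟩
    have hr : (lineCharts hbi x n).symm s ∈ (lineCharts hbi x n).source := arc_symm_mem (lineCharts_target hbi n) s
    have hgr : lineCharts hbi x n ((lineCharts hbi x n).symm s) = s := arc_apply_symm (lineCharts_target hbi n) s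
    exact ⟨(leafLT_iff hp hr).2 (by rw [hgr]; exact hs₁), (leafLT_iff hr hq).2 (by rw [hgr]; exact hs₂)⟩

/-- **Open order intervals are preconnected.** [folklore] -/
theorem isPreconnected_leafIoo (p q : F.Leaf x) : IsPreconnected (leafIoo hbi p q) := by
  obtain ⟨n, hp, hq⟩ := exists_mem_lineCharts_source₂ hbi p q
  rw [leafIoo_eq_image hp hq]
  exact isPreconnected_Ioo.image _ (arc_continuous_symm (lineCharts_target hbi n)).continuousOn

end OpenLeaf

end Literature.Topology.PlanarFoliations
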